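import Summits.BirchSwinnertonDyer.BirchSwinnertonDyer.Theorems.PrintCFramBottomClassIndexLawFiveLeGenusInternalStrippedDatumBSDp
import Summits.BirchSwinnertonDyer.BirchSwinnertonDyer.Theorems.PrintCFramBottomClassIndexLawFiveLeGenusInternalHeegnerSeven
import Summits.BirchSwinnertonDyer.BirchSwinnertonDyer.Theorems.PrintCFramBottomClassIndexLawFiveLeKrizLiBinders
import HarnessLib

/-!
# Crux `PrintCFram.BottomClassIndexLawFiveLe` (stmt-BirchSwinnertonDyer-20372), line `eisenstein-resource-bdp-line` (registry v25):
# the genus-internal branch at `p = 7` — `BSD₇` OF THE RANK-ONE MEMBER `W ≅ X₀(49)^{(d_K)}` OVER A `7`-REGULAR TWISTING FIELD,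
# from print (the kernel arrow of the card's `stub_twistingFieldSeven`)

Cell `bsd-print-cfram`, width seat `bsd-line-cfram-p1-w7` (g7); `--supports stmt-BirchSwinnertonDyer-20372` (helper). THEOREMS ONLY;
no definition, no named fact, no `sorry`. BSD is not proved by any of this; no summit statement is proved by this seat; the crux stays
OPEN, no registered stub is closed, and the reshape of `stub_seedOffExc` that this arrow makes possible is the LEAD's.

WHAT THIS FILE IS. The composition of w6 g8's P1 (`…GenusInternalHeegnerSeven`: Kriz–Li's block for `(cm7, 7, ψ = ω²)` over a
`7`-regular Heegner field `K` of `X₀(49)`, the Bernoulli pair (4) = `reg·B_{1,ω}` by the Kummer congruence) with this seat's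
oriented kernel (`…GenusInternalStrippedDatumBSDp.bsdp_twist_of_strippedKrizLiDatum_of_prints`: `BSD_p` of the rank-one twist from a
Kriz–Li datum of the stripped curve, Manin-robust, parity-free in `d_K`):

* `bsdp_twist_cm7_of_regular` — the four refereed print facts ∧ Kriz–Li Thm. 1.20 ⊢ for `K` imaginary quadratic, Heegner for `49`
  (i.e. `7` split), `d_K < −4`, `ε_K` Kronecker, ANY primitive `χ` mod `m ⊥ 7` agreeing with `ε_K` off a finite set and REGULAR in the
  registry's spelling `¬ ‖((7 − 2 : ℕ) : ℚ_[7])⁻¹ * generalizedBernoulli (7 − 2) χ‖ ≤ 7⁻¹`, and ANY globally minimal `W ≅ cm7^{(d_K)}` with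
  `W.analyticRank = 1`: **`BSDp W 7`**;
* `bsdp_twist_cm7_of_regular_kronecker` — the same with `χ := ε_K`;
* `bsdp_of_isIsogenous_twist_cm7_of_regular_kronecker` — the same for any globally minimal `W` of analytic rank one ISOGENOUS to a minimal
  model of the twist (Cassels) — the datum currency of the routing socket GI-R (w2 g14).

In the registry's terms: a rank-one class member at `p = 7` is `W ≅ A(7)^{(e*)}` with class character `χ_{e*}`; when `(e*/7) = +1`
the twisting field `K = ℚ(√e*)` is Heegner for `49`, `ε_K` agrees with `χ_{e*}` at every prime, and the class's own regularity
`reg(e) = 7 ∤ B_{5,χ_{e*}}/5` gives `BSD₇(W)` with NO admissible split Heegner field `K₀` — the classes `e* ∈ {−83, −87, −139, −143}`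
(odd) and `{−52, −104}` (even) of LEAD g13's exceptional off-locus window leave `stub_seedOffExc` by print (critic V#146/V#146b);
`−39`, `−123` (`(e*/7) = −1`) do not. CONDITIONAL on the named facts; beyond-print theorem: NO.
References: [KrizLi2019] Thm. 1.20, Rem. 1.21; [GrossZagier1986] I.(6.3), (7.3); [CastellaGrossiLeeSkinner2022] (5.5)–(5.7);
[BurungaleFlach2024] Cor. 2; [Washington1997] Thm. 5.11, Cor. 5.13; [Mazur1978] Prop. 6.3.
-/

set_option autoImplicit false
-- the summit namespace `Summit.BirchSwinnertonDyer.BirchSwinnertonDyer` repeats the problem name by design (D-0017)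
set_option linter.dupNamespace false

noncomputable section

open scoped Classical

open WeierstrassCurve NumberField DirichletCharacter
open Literature.NumberTheory Literature.NumberTheory.EllipticCurves
  Literature.NumberTheory.EllipticCurves.ModularForms
open Literature.NumberTheory.EllipticCurves.KrizLi2019 Literature.NumberTheory.LFunctions
open Literature.NumberTheory.EllipticCurves.Rank1Residual
open Summit.BirchSwinnertonDyer.Rank1Residual
open Summit.BirchSwinnertonDyer.Rank1Residual.X12.O11.RouteU
open Summit.BirchSwinnertonDyer.BirchSwinnertonDyer.Theses.UniversalToricDescent
open Summit.BirchSwinnertonDyer.BirchSwinnertonDyer.Theorems.GoldfeldGoodTwists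

namespace Summit.BirchSwinnertonDyer.BirchSwinnertonDyer.Theorems.PrintCFram.GenusInternal

open Summit.BirchSwinnertonDyer.BirchSwinnertonDyer.Theorems.PrintCFram

/-- **`BSD₇` of the rank-one twist of `X₀(49)` by a `7`-regular Heegner field, from print** (genus-internal branch at `p = 7`;
critic V#146 P2 / V#146b). Inputs BY NAME: the four refereed facts of `stub_prints5`'s first conjunct (Hsieh 2014 Thm. A,
Liu–Zhang–Zhang 2018, `ToricPublishedInputs`, Burungale–Flach 2024 Cor. 2) and Kriz–Li 2019 Thm. 1.20. Data: `K` imaginary quadratic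
with the Heegner hypothesis for `49` and `d_K < −4` (either parity), its Kronecker character `ε_K`, a primitive `χ` mod `m ⊥ 7` agreeing
with `ε_K` at the primes `ℓ ∤ N₀` and REGULAR (`¬ ‖((7 − 2 : ℕ) : ℚ_[7])⁻¹ * generalizedBernoulli (7 − 2) χ‖ ≤ 7⁻¹`, the spelling of
`stub_seedOffExc`), and any globally minimal `W ≅ cm7^{(d_K)}` with `W.analyticRank = 1`. Conclusion: `BSDp W 7`. Proof: Heegner data of
`cm7` over `K` (`ToricPublishedInputs.exists_isHeegnerPoint`), w6 g8's block at `(cm7, 7, ω²)` with (4) from regularity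
(`bernoulli_hypothesis_cm7_of_regular`), and `bsdp_twist_of_strippedKrizLiDatum_of_prints` at `V = cm7`.
[cite: KrizLi2019, Thm. 1.20 (pp. 7–8) and Rem. 1.21 (p. 8)] [cite: BurungaleFlach2024, Thm. 1.1 and Cor. 2]
[cite: GrossZagier1986, Thm. I.(6.3) and (7.3)] [cite: Mazur1978, Prop. 6.3 (1) (p. 153)] -/
theorem bsdp_twist_cm7_of_regular
    (hprints : Hsieh2014.thmA_exists_isHsiehLFunction_unrPeriod_anyLevel ∧
      LiuZhangZhang2018.thm151_thm153_modularCurve_heegnerVector_additive ∧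
      ToricPublishedInputs ∧
      bsdTriple_of_hasCM_of_L_one_ne_zero)
    (hKL : thm120_padicLogHeegner_unit_of_bernoulli)
    (K : Type) [Field K] [NumberField K] (hK : IsImaginaryQuadratic K) (hH : SatisfiesHeegnerHypothesis 49 K)
    (hd4 : NumberField.discr K < -4)
    (εK : DirichletCharacter ℚ_[7] (NumberField.discr K).natAbs) (hεK : IsKroneckerCharacterOf K εK)
    {m : ℕ} [NeZero m] (χ : DirichletCharacter ℚ_[7] m) (hχ : χ.IsPrimitive) (hm7 : m.Coprime 7)
    {N₀ : ℕ} (hN₀ : N₀ ≠ 0)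
    (hχε : ∀ ℓ : ℕ, ℓ.Prime → ¬ ℓ ∣ N₀ → χ (ℓ : ZMod m) = εK (ℓ : ZMod (NumberField.discr K).natAbs))
    (hreg : ¬ ‖((7 - 2 : ℕ) : ℚ_[7])⁻¹ * generalizedBernoulli (7 - 2) χ‖ ≤ (7 : ℝ)⁻¹)
    (W : WeierstrassCurve ℚ) [W.IsElliptic] [W.IsGloballyMinimal]
    (hW : ∃ C : VariableChange ℚ, C • cm7.quadraticTwist (NumberField.discr K : ℚ) = W) (hr : W.analyticRank = 1) :
    BSDp W 7 := by
  haveI h7 : Fact (Nat.Prime 7) := ⟨by norm_num⟩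
  haveI : NeZero (cm7.conductorNorm ℤ) := ⟨(cm7.conductorNorm_pos_holds).ne'⟩
  -- the stripped curve `cm7 = 49a1`: CM, CM-ramified at `7`
  have hCM : cm7.HasCM := hasCM_cm7'
  have hram : CMRamified cm7 7 := KrizLiBinders.cmRamified_bases.1
  -- Heegner data of `cm7` over `K` at level `N(X₀(49)) = 49` (Gross–Zagier I §4, inside `ToricPublishedInputs`)
  have hH' : SatisfiesHeegnerHypothesis (cm7.conductorNorm ℤ) K := by rw [conductorNorm_cm7]; exact hH
  obtain ⟨-, -, ⟨-, -, -, -, -, -, -, -, -, hHP⟩, -⟩ := id hprints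
  obtain ⟨P, Dt, H, ι, hP⟩ := hHP cm7 K hK hH'
  -- Kriz–Li's block at `(cm7, 7, ψ = ω²)` (bsd-goldfeld T1 + w6 g8 P1)
  obtain ⟨ω, hω⟩ := exists_isTeichmullerCharacter (p := 7)
  have h4 := bernoulli_hypothesis_cm7_of_regular ω hω εK χ hχ hm7 hN₀ hχε hreg
  exact bsdp_twist_of_strippedKrizLiDatum_of_prints hprints hKL cm7 hCM hram (by norm_num) (cm7.conductorNorm ℤ) K Dt H ι P
    rfl hK hH' hd4 hP 7 (ω ^ 2) ω (teichmuller_sq_isPrimitive ω hω) hω (hss_cm7_teichmuller_sq ω hω)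
    (teichmuller_sq_apply_seven_ne_one ω) (primVal_invMulOmega_teichmuller_sq_seven_ne_one ω hω)
    (fun ℓ hℓ h7' hbad => by
      haveI := Fact.mk hℓ
      exact absurd (hasGoodReductionAtPrime_cm7 ℓ h7') hbad.1)
    εK hεK h4 W hW hr

/-- **The same in Kronecker currency (`χ := ε_K`): `BSD₇(W)` for every globally minimal `W ≅ X₀(49)^{(d_K)}` of analytic rank one over a
`7`-REGULAR (`7 ∤ B_{5,ε_K}/5`) imaginary quadratic Heegner field `K` of `X₀(49)` with `d_K < −4`**, from the four print facts and Kriz–Li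
Thm. 1.20. [cite: KrizLi2019, Thm. 1.20 (pp. 7–8) and Rem. 1.21 (p. 8)] [cite: BurungaleFlach2024, Cor. 2] [cite: GrossZagier1986, Thm. I.(6.3) and (7.3)] -/
theorem bsdp_twist_cm7_of_regular_kronecker
    (hprints : Hsieh2014.thmA_exists_isHsiehLFunction_unrPeriod_anyLevel ∧
      LiuZhangZhang2018.thm151_thm153_modularCurve_heegnerVector_additive ∧
      ToricPublishedInputs ∧
      bsdTriple_of_hasCM_of_L_one_ne_zero)
    (hKL : thm120_padicLogHeegner_unit_of_bernoulli)
    (K : Type) [Field K] [NumberField K] (hK : IsImaginaryQuadratic K) (hH : SatisfiesHeegnerHypothesis 49 K)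
    (hd4 : NumberField.discr K < -4)
    (εK : DirichletCharacter ℚ_[7] (NumberField.discr K).natAbs) (hεK : IsKroneckerCharacterOf K εK)
    (hreg : ¬ ‖(5 : ℚ_[7])⁻¹ * generalizedBernoulli 5 εK‖ ≤ (7 : ℝ)⁻¹)
    (W : WeierstrassCurve ℚ) [W.IsElliptic] [W.IsGloballyMinimal]
    (hW : ∃ C : VariableChange ℚ, C • cm7.quadraticTwist (NumberField.discr K : ℚ) = W) (hr : W.analyticRank = 1) :
    BSDp W 7 := by
  haveI : NeZero (NumberField.discr K).natAbs := ⟨Int.natAbs_ne_zero.mpr (NumberField.discr_ne_zero K)⟩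
  have h7d : ¬ 7 ∣ (NumberField.discr K).natAbs := by
    rw [← Int.natCast_dvd]
    exact Literature.SatisfiesHeegnerHypothesis.not_dvd_discr hK.1 hH (by norm_num) (by norm_num)
  have hd7 : (NumberField.discr K).natAbs.Coprime 7 :=
    ((Nat.Prime.coprime_iff_not_dvd (by norm_num)).mpr h7d).symm
  exact bsdp_twist_cm7_of_regular hprints hKL K hK hH hd4 εK hεK εK hεK.1 hd7 one_ne_zero (fun _ _ _ => rfl) hreg W hW hr

/-- **Isogeny-class form (the datum currency of w2 g14's routing socket GI-R): `BSD₇(W)` for every globally minimal `W` of analytic rank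
one that is `ℚ`-ISOGENOUS to a globally minimal model `W₁` of `X₀(49)^{(d_K)}`, `K` a `7`-regular imaginary quadratic Heegner field of
`X₀(49)` with `d_K < −4`.** Proof: `ord_{s=1} L` is an isogeny invariant (`analyticRank_eq_of_isIsogenous'`), the previous theorem at `W₁`,
and Cassels' invariance of the BSD quotient (`X2.bsdp_of_isIsogenous_of_bsdp`, `bsdRHS_eq_of_isIsogenous` inside the print bundle). Every
rank-one CM curve with `j ∈ {−3375, 16581375}` CM-ramified at `7` is such a `W` for its twisting parameter (the routing is GI-R's / the LEAD's).
[cite: KrizLi2019, Thm. 1.20 (pp. 7–8) and Rem. 1.21 (p. 8)] [cite: Cassels1965ArithmeticVIII] [cite: MilneADT2006, Thm. I.7.3] -/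
theorem bsdp_of_isIsogenous_twist_cm7_of_regular_kronecker
    (hprints : Hsieh2014.thmA_exists_isHsiehLFunction_unrPeriod_anyLevel ∧
      LiuZhangZhang2018.thm151_thm153_modularCurve_heegnerVector_additive ∧
      ToricPublishedInputs ∧
      bsdTriple_of_hasCM_of_L_one_ne_zero)
    (hKL : thm120_padicLogHeegner_unit_of_bernoulli)
    (W : WeierstrassCurve ℚ) [W.IsElliptic] [W.IsGloballyMinimal] (hr : W.analyticRank = 1)
    (K : Type) [Field K] [NumberField K] (hK : IsImaginaryQuadratic K) (hH : SatisfiesHeegnerHypothesis 49 K)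
    (hd4 : NumberField.discr K < -4)
    (εK : DirichletCharacter ℚ_[7] (NumberField.discr K).natAbs) (hεK : IsKroneckerCharacterOf K εK)
    (hreg : ¬ ‖(5 : ℚ_[7])⁻¹ * generalizedBernoulli 5 εK‖ ≤ (7 : ℝ)⁻¹)
    (W₁ : WeierstrassCurve ℚ) [W₁.IsElliptic] [W₁.IsGloballyMinimal] (C : VariableChange ℚ)
    (hiso : IsIsogenous W W₁) (hW₁ : C • W₁ = cm7.quadraticTwist (NumberField.discr K : ℚ)) :
    BSDp W 7 := by
  haveI h7 : Fact (Nat.Prime 7) := ⟨by norm_num⟩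
  obtain ⟨-, -, ⟨-, -, hGZK, -⟩, -, -, hmod, hCas⟩ := Theorems.PrintCFram.InputsPrints.prints7_of_prints4 hprints
  have hr₁ : W₁.analyticRank = 1 := by rw [← analyticRank_eq_of_isIsogenous' hiso]; exact hr
  have hW₁' : ∃ C' : VariableChange ℚ, C' • cm7.quadraticTwist (NumberField.discr K : ℚ) = W₁ :=
    ⟨C⁻¹, by rw [← hW₁, inv_smul_smul]⟩
  have h₁ : BSDp W₁ 7 := bsdp_twist_cm7_of_regular_kronecker hprints hKL K hK hH hd4 εK hεK hreg W₁ hW₁' hr₁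
  exact X2.bsdp_of_isIsogenous_of_bsdp hCas hGZK hmod W₁ W hiso.symm_of_charZero 7 hr₁.le h₁

end Summit.BirchSwinnertonDyer.BirchSwinnertonDyer.Theorems.PrintCFram.GenusInternal

end
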